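import Summits.QuantumFields.YangMills.Theorems.LangevinControlUVFemtoCurvatureTwoPointRateFreeEncoding
import Summits.QuantumFields.YangMills.Theorems.LangevinControlUVFemtoCurvatureTwoPointDefs
import Summits.QuantumFields.YangMills.Theorems.FemtoCurvatureTwoPoint.Negative.PlaquetteFreezing
import Summits.QuantumFields.YangMills.Theorems.LangevinControlUVOSLegsFromFemtoAndGapStubPinAux

/-!
# Crux `FemtoCurvatureTwoPoint` (stmt-QuantumFields-9363, route `LangevinControlUV`):
# the rate-free encoding, III — the typed item from the eventual shape-free bounds

Support file of the line `generic-step-gamma-encoding` (`--supports stmt-QuantumFields-9363`; registered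
name `femtoCurvatureTwoPoint_of_shapeFree`, lead c3 reshape 4; this reconstruction by the item prover after
the lead's part III bounced for a then-missing olean). Part III of three (`…RateFreeAux` ⊂ `…RateFreeEncoding`
⊂ this): the abstract rate-free encoding `RateFree.shapeFree_encoding` (landed, part II) applied to the Wilson
plaquette-covariance functional of a faithful lattice representation — continuity in `β` (tree
`OSLegsFromFemtoAndGap.continuous_axisCov`) and freezing (`Negative.PlaquetteFreezing.tendsto_plaquetteCov_rep`)
are theorems — so that the typed item `FemtoCurvatureTwoPoint` follows from the EVENTUAL SHAPE-FREE BOUNDS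
(the converse of the disprover's `PackageWith.esfb`): one constant `K`, and for every ceiling `L₀` a threshold
beyond which, for all tori `L, L' ≤ L₀` and `1 ≤ n ≤ L/8`, the reference axis covariance is positive
(`stub_axisPositive`, PROVED: `…StrictRPAxisPositive`), comparable across tori (`stub_crossTorus`, open:
fixed-torus semiclassics) and dominates every pair at torus distance `n` (`stub_pairDomination`, open).
-/

set_option autoImplicit false

noncomputable section

open Filter Topology MeasureTheory
open Literature.MathematicalPhysics.QuantumFieldTheory
open Summit.QuantumFields.YangMills.Cruxes.FemtoCurvatureTwoPoint.GenericStepGammaEncoding (CruxAt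
  femtoCurvatureTwoPoint_iff_cruxAt)

namespace Summit.QuantumFields.YangMills.Theorems.FemtoCurvatureTwoPoint.RateFree

/-- **The crux body at `(G, r)` from the eventual shape-free bounds at `(G, r)`.** [folklore] -/
theorem cruxAt_of_shapeFree {G : Type} [Group G] [TopologicalSpace G] [IsTopologicalGroup G]
    [CompactSpace G] [MeasurableSpace G] [BorelSpace G] (r : LatticeRep G)
    (H : ∃ K : ℝ, 0 < K ∧ ∀ L₀ : ℕ, ∃ T : ℝ, ∀ β : ℝ, T ≤ β → ∀ (L L' : ℕ) [NeZero L] [NeZero L'] (n : ℕ), 1 ≤ n → 8 * n ≤ L → L ≤ L₀ → L' ≤ L₀ → 0 < wilsonExpectation r.ρ β (fun U : GaugeConfig 4 L G => ((r.N : ℝ) - (r.ρ (plaquetteHolonomy U 0 0 1)).trace.re) * ((r.N : ℝ) - (r.ρ (plaquetteHolonomy U (Pi.single (2 : Fin 4) ((n : ℕ) : ZMod L)) 0 1)).trace.re)) - wilsonExpectation r.ρ β (fun U : GaugeConfig 4 L G => (r.N : ℝ) - (r.ρ (plaquetteHolonomy U 0 0 1)).trace.re) * wilsonExpectation r.ρ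 β (fun U : GaugeConfig 4 L G => (r.N : ℝ) - (r.ρ (plaquetteHolonomy U (Pi.single (2 : Fin 4) ((n : ℕ) : ZMod L)) 0 1)).trace.re) ∧ (8 * n ≤ L' → wilsonExpectation r.ρ β (fun U : GaugeConfig 4 L' G => ((r.N : ℝ) - (r.ρ (plaquetteHolonomy U 0 0 1)).trace.re) * ((r.N : ℝ) - (r.ρ (plaquetteHolonomy U (Pi.single (2 : Fin 4) ((n : ℕ) : ZMod L')) 0 1)).trace.re)) - wilsonExpectation r.ρ β (fun U : GaugeConfig 4 L' G => (r.N : ℝ) - (r.ρ (plaquetteHolonomy U 0 0 1)).trace.re) * wilsonExpectation r.ρ β (fun U : GaugeConfig 4 L' G => (r.N : ℝ) - (r.ρ (plaquetteHolonomy U (Pi.single (2 : Fin 4) ((n : ℕ) : ZMod L')) 0 1)).trace.re) ≤ K * (wilsonExpectation r.ρ β (fun U : GaugeConfig 4 L G => ((r.N : ℝ) - (r.ρ (plaquetteHolonomy U 0 0 1)).trace.re) * ((r.N : ℝ) - (r.ρ (plaquetteHolonomy U (Pi.single (2 : Fin 4) ((n : ℕ) : ZMod L)) 0 1)).trace.re))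 - wilsonExpectation r.ρ β (fun U : GaugeConfig 4 L G => (r.N : ℝ) - (r.ρ (plaquetteHolonomy U 0 0 1)).trace.re) * wilsonExpectation r.ρ β (fun U : GaugeConfig 4 L G => (r.N : ℝ) - (r.ρ (plaquetteHolonomy U (Pi.single (2 : Fin 4) ((n : ℕ) : ZMod L)) 0 1)).trace.re))) ∧ ∀ (x y : Fin 4 → ZMod L') (i j i' j' : Fin 4), x ≠ y → i ≠ j → i' ≠ j' → Real.sqrt (∑ k : Fin 4, (((x k - y k).valMinAbs : ℤ) : ℝ) ^ 2) = n → |wilsonExpectation r.ρ β (fun U : GaugeConfig 4 L' G => ((r.N : ℝ) - (r.ρ (plaquetteHolonomy U x i j)).trace.re) * ((r.N : ℝ) - (r.ρ (plaquetteHolonomy U y i' j')).trace.re)) - wilsonExpectation r.ρ β (fun U : GaugeConfig 4 L' G => (r.N : ℝ) - (r.ρ (plaquetteHolonomy U x i j)).trace.re) * wilsonExpectation r.ρ β (fun U : GaugeConfig 4 L' G => (r.N : ℝ) - (r.ρ (plaquetteHolonomy U y i' j')).trace.re)| ≤ K * (wilsonExpectation r.ρ β (fun U : GaugeConfig 4 L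 G => ((r.N : ℝ) - (r.ρ (plaquetteHolonomy U 0 0 1)).trace.re) * ((r.N : ℝ) - (r.ρ (plaquetteHolonomy U (Pi.single (2 : Fin 4) ((n : ℕ) : ZMod L)) 0 1)).trace.re)) - wilsonExpectation r.ρ β (fun U : GaugeConfig 4 L G => (r.N : ℝ) - (r.ρ (plaquetteHolonomy U 0 0 1)).trace.re) * wilsonExpectation r.ρ β (fun U : GaugeConfig 4 L G => (r.N : ℝ) - (r.ρ (plaquetteHolonomy U (Pi.single (2 : Fin 4) ((n : ℕ) : ZMod L)) 0 1)).trace.re))) :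
    CruxAt r := by
  classical
  -- the covariance functional (junk `0` on the empty torus `L = 0`)
  let Φ : (L : ℕ) → ℝ → (Fin 4 → ZMod L) → Fin 4 → Fin 4 → (Fin 4 → ZMod L) → Fin 4 → Fin 4 → ℝ :=
    fun L β x i j y i' j' =>
      if hL : L = 0 then 0 else
        haveI : NeZero L := ⟨hL⟩
        wilsonExpectation (d := 4) (L := L) r.ρ β (fun U : GaugeConfig 4 L G =>
            ((r.N : ℝ) - (r.ρ (plaquetteHolonomy U x i j)).trace.re) *
              ((r.N : ℝ) - (r.ρ (plaquetteHolonomy U y i' j')).trace.re)) -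
          wilsonExpectation (d := 4) (L := L) r.ρ β (fun U : GaugeConfig 4 L G =>
              (r.N : ℝ) - (r.ρ (plaquetteHolonomy U x i j)).trace.re) *
            wilsonExpectation (d := 4) (L := L) r.ρ β (fun U : GaugeConfig 4 L G =>
              (r.N : ℝ) - (r.ρ (plaquetteHolonomy U y i' j')).trace.re)
  have hΦ : ∀ (L : ℕ) [NeZero L] (β : ℝ) (x : Fin 4 → ZMod L) (i j : Fin 4) (y : Fin 4 → ZMod L)
      (i' j' : Fin 4), Φ L β x i j y i' j' =
      wilsonExpectation (d := 4) (L := L) r.ρ β (fun U : GaugeConfig 4 L G =>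
            ((r.N : ℝ) - (r.ρ (plaquetteHolonomy U x i j)).trace.re) *
              ((r.N : ℝ) - (r.ρ (plaquetteHolonomy U y i' j')).trace.re)) -
          wilsonExpectation (d := 4) (L := L) r.ρ β (fun U : GaugeConfig 4 L G =>
              (r.N : ℝ) - (r.ρ (plaquetteHolonomy U x i j)).trace.re) *
            wilsonExpectation (d := 4) (L := L) r.ρ β (fun U : GaugeConfig 4 L G =>
              (r.N : ℝ) - (r.ρ (plaquetteHolonomy U y i' j')).trace.re) := by
    intro L _ β x i j y i' j'
    simp only [Φ, dif_neg (NeZero.ne L)]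
  have hcont : ∀ (L : ℕ), L ≠ 0 → ∀ (x : Fin 4 → ZMod L) (i j : Fin 4) (y : Fin 4 → ZMod L)
      (i' j' : Fin 4), Continuous fun β => Φ L β x i j y i' j' := by
    intro L hL x i j y i' j'
    haveI : NeZero L := ⟨hL⟩
    simp only [hΦ]
    simpa only [one_mul] using OSLegsFromFemtoAndGap.continuous_axisCov r x y i j i' j' 1
  have hfreeze : ∀ (L : ℕ), L ≠ 0 → ∀ (x : Fin 4 → ZMod L) (i j : Fin 4) (y : Fin 4 → ZMod L)
      (i' j' : Fin 4), Tendsto (fun β => Φ L β x i j y i' j') atTop (𝓝 0) := by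
    intro L hL x i j y i' j'
    haveI : NeZero L := ⟨hL⟩
    simp only [hΦ]
    exact Negative.PlaquetteFreezing.tendsto_plaquetteCov_rep r x y i j i' j'
  -- the eventual shape-free bounds in terms of `Φ`
  have H' : ∃ K : ℝ, 0 < K ∧ ∀ L₀ : ℕ, ∃ T : ℝ, ∀ β : ℝ, T ≤ β →
      ∀ (L L' n : ℕ), 1 ≤ L' → 1 ≤ n → 8 * n ≤ L → L ≤ L₀ → L' ≤ L₀ →
        0 < Φ L β 0 0 1 (Pi.single (2 : Fin 4) ((n : ℕ) : ZMod L)) 0 1 ∧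
        (8 * n ≤ L' → Φ L' β 0 0 1 (Pi.single (2 : Fin 4) ((n : ℕ) : ZMod L')) 0 1 ≤
            K * Φ L β 0 0 1 (Pi.single (2 : Fin 4) ((n : ℕ) : ZMod L)) 0 1) ∧
        ∀ (x y : Fin 4 → ZMod L') (i j i' j' : Fin 4), x ≠ y → i ≠ j → i' ≠ j' →
          Real.sqrt (∑ k : Fin 4, (((x k - y k).valMinAbs : ℤ) : ℝ) ^ 2) = n →
            |Φ L' β x i j y i' j'| ≤ K * Φ L β 0 0 1 (Pi.single (2 : Fin 4) ((n : ℕ) : ZMod L)) 0 1 := by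
    obtain ⟨K, hK, hT⟩ := H
    refine ⟨K, hK, fun L₀ => ?_⟩
    obtain ⟨T, hTβ⟩ := hT L₀
    refine ⟨T, fun β hβ L L' n hL' hn hnL hLL₀ hL'L₀ => ?_⟩
    haveI : NeZero L := ⟨by omega⟩
    haveI : NeZero L' := ⟨by omega⟩
    obtain ⟨h1, h2, h3⟩ := hTβ β hβ L L' n hn hnL hLL₀ hL'L₀
    refine ⟨by rw [hΦ]; exact h1, fun h8 => by rw [hΦ, hΦ]; exact h2 h8,
      fun x y i j i' j' hxy hij hij' hd => by rw [hΦ, hΦ]; exact h3 x y i j i' j' hxy hij hij' hd⟩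
  obtain ⟨a, Γ, β₀, c, C, hc, ha, ha0, hΓ, hmain⟩ := shapeFree_encoding Φ hcont hfreeze H'
  refine ⟨a, Γ, β₀, 1, c, C, one_pos, hc, ha, ha0, fun s _ _ => hΓ s, ?_⟩
  intro L _ β hβ hLa P E cov dist
  obtain ⟨hax, hpair⟩ := hmain L (NeZero.ne L) β hβ hLa
  refine ⟨fun n hn hnL => ?_, fun x y i j i' j' hxy hij hij' => ?_⟩
  · have h := hax n hn hnL
    rw [hΦ] at h
    exact h
  · have h := hpair x y i j i' j' hxy hij hij'
    rw [hΦ] at h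
    exact h

/-- **Registered composition `femtoCurvatureTwoPoint_of_shapeFree`** (rate-free skeleton of line
`generic-step-gamma-encoding`, reshape 4; `--supports stmt-QuantumFields-9363`): the typed item
`FemtoCurvatureTwoPoint` follows from the eventual shape-free bounds (positivity — PROVED,
`stub_axisPositive`; cross-torus comparability `stub_crossTorus` and pair domination
`stub_pairDomination` — open), by `cruxAt_of_shapeFree` at every `(G, r)`. [folklore] -/
theorem femtoCurvatureTwoPoint_of_shapeFree (H : ∀ (G : Type) [Group G] [TopologicalSpace G] [IsTopologicalGroup G] [CompactSpace G] [MeasurableSpace G] [BorelSpace G], IsCompactSimpleLieGroup G → ∀ r : LatticeRep G, ∃ K : ℝ, 0 < K ∧ ∀ L₀ : ℕ, ∃ T : ℝ, ∀ β : ℝ, T ≤ β → ∀ (L L' : ℕ) [NeZero L] [NeZero L'] (n : ℕ), 1 ≤ n → 8 * n ≤ L → L ≤ L₀ → L' ≤ L₀ → 0 < wilsonExpectation r.ρ β (fun U : GaugeConfig 4 L G => ((r.N : ℝ) - (r.ρ (plaquetteHolonomy U 0 0 1)).trace.re) * ((r.N : ℝ) - (r.ρ (plaquetteHolonomy U (Pi.single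 (2 : Fin 4) ((n : ℕ) : ZMod L)) 0 1)).trace.re)) - wilsonExpectation r.ρ β (fun U : GaugeConfig 4 L G => (r.N : ℝ) - (r.ρ (plaquetteHolonomy U 0 0 1)).trace.re) * wilsonExpectation r.ρ β (fun U : GaugeConfig 4 L G => (r.N : ℝ) - (r.ρ (plaquetteHolonomy U (Pi.single (2 : Fin 4) ((n : ℕ) : ZMod L)) 0 1)).trace.re) ∧ (8 * n ≤ L' → wilsonExpectation r.ρ β (fun U : GaugeConfig 4 L' G => ((r.N : ℝ) - (r.ρ (plaquetteHolonomy U 0 0 1)).trace.re) * ((r.N : ℝ) - (r.ρ (plaquetteHolonomy U (Pi.single (2 : Fin 4) ((n : ℕ) : ZMod L')) 0 1)).trace.re)) - wilsonExpectation r.ρ β (fun U : GaugeConfig 4 L' G => (r.N : ℝ) - (r.ρ (plaquetteHolonomy U 0 0 1)).trace.re) * wilsonExpectation r.ρ β (fun U : GaugeConfig 4 L' G => (r.N : ℝ) - (r.ρ (plaquetteHolonomy U (Pi.single (2 : Fin 4) ((n : ℕ) : ZMod L')) 0 1)).trace.re) ≤ K * (wilsonExpectation r.ρ β (fun U : GaugeConfig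 4 L G => ((r.N : ℝ) - (r.ρ (plaquetteHolonomy U 0 0 1)).trace.re) * ((r.N : ℝ) - (r.ρ (plaquetteHolonomy U (Pi.single (2 : Fin 4) ((n : ℕ) : ZMod L)) 0 1)).trace.re)) - wilsonExpectation r.ρ β (fun U : GaugeConfig 4 L G => (r.N : ℝ) - (r.ρ (plaquetteHolonomy U 0 0 1)).trace.re) * wilsonExpectation r.ρ β (fun U : GaugeConfig 4 L G => (r.N : ℝ) - (r.ρ (plaquetteHolonomy U (Pi.single (2 : Fin 4) ((n : ℕ) : ZMod L)) 0 1)).trace.re))) ∧ ∀ (x y : Fin 4 → ZMod L') (i j i' j' : Fin 4), x ≠ y → i ≠ j → i' ≠ j' → Real.sqrt (∑ k : Fin 4, (((x k - y k).valMinAbs : ℤ) : ℝ) ^ 2) = n → |wilsonExpectation r.ρ β (fun U : GaugeConfig 4 L' G => ((r.N : ℝ) - (r.ρ (plaquetteHolonomy U x i j)).trace.re) * ((r.N : ℝ) - (r.ρ (plaquetteHolonomy U y i' j')).trace.re)) - wilsonExpectation r.ρ β (fun U : GaugeConfig 4 L' G => (r.N : ℝ) - (r.ρ (plaquetteHolonomy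 U x i j)).trace.re) * wilsonExpectation r.ρ β (fun U : GaugeConfig 4 L' G => (r.N : ℝ) - (r.ρ (plaquetteHolonomy U y i' j')).trace.re)| ≤ K * (wilsonExpectation r.ρ β (fun U : GaugeConfig 4 L G => ((r.N : ℝ) - (r.ρ (plaquetteHolonomy U 0 0 1)).trace.re) * ((r.N : ℝ) - (r.ρ (plaquetteHolonomy U (Pi.single (2 : Fin 4) ((n : ℕ) : ZMod L)) 0 1)).trace.re)) - wilsonExpectation r.ρ β (fun U : GaugeConfig 4 L G => (r.N : ℝ) - (r.ρ (plaquetteHolonomy U 0 0 1)).trace.re) * wilsonExpectation r.ρ β (fun U : GaugeConfig 4 L G => (r.N : ℝ) - (r.ρ (plaquetteHolonomy U (Pi.single (2 : Fin 4) ((n : ℕ) : ZMod L)) 0 1)).trace.re))) : Summit.QuantumFields.YangMills.Theses.LangevinControlUV.FemtoCurvatureTwoPoint := by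
  rw [femtoCurvatureTwoPoint_iff_cruxAt]
  intro G _ _ _ _ hG
  letI : MeasurableSpace G := borel G
  haveI : BorelSpace G := ⟨rfl⟩
  intro r
  exact cruxAt_of_shapeFree r (H G hG r)

end Summit.QuantumFields.YangMills.Theorems.FemtoCurvatureTwoPoint.RateFree

end
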